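import Summits.BirchSwinnertonDyer.BirchSwinnertonDyer.Theorems.SignedLowerHalvesSmallImageLowerHalfBothSignsRttJunctionEulerDict
import Summits.BirchSwinnertonDyer.BirchSwinnertonDyer.Theorems.SignedLowerHalvesSmallImageLowerHalfBothSignsRttE2NumHeadlinePlaces
import Literature.NumberTheory.EllipticCurves.AdditiveReductionSemistableModelProofs
import HarnessLib

/-!
# Route `SignedLowerHalves`, crux L `SmallImageLowerHalfBothSigns` (stmt-BirchSwinnertonDyer-23599), line `rtt_w3` **v25** — row **S1c** (`stub_junctionEulerId_ns`), part 2: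
# THE EULER IDENTITY OF THE STRUCTURAL DEPLETION FROM THE EULER-FACTOR DICTIONARY — `ι(JunctionDepletion) = C c′ · JunctionEuler p S₀ g ι (−f)`

INPUTS hand `bsd-inputs-honda-p1` g27 under LEAD `cruxlead-stmt-BirchSwinnertonDyer-23599` g13 (cell `bsd-ssimc`); helper `--supports stmt-BirchSwinnertonDyer-23599`.
THEOREMS ONLY: no definition, no named fact, no instance, no `sorry`. Part 1 = `…RttJunctionEulerDict` (the orientation dictionary `x_w = −f(w∣ℓ)·f_ℓ`,
`u_w = N(w)/θ(φ_w)₀₀`, one-factor algebra, the fibres of `T` over `S₀`).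

WHAT. v25 (LEAD g13, 04:43Z; honda g27 audit, evidence #44) re-typed row S1c as «∃ fv u c′, c′ ≠ 0 ∧ (∀ ℓ ∈ S₀, fv ℓ ≠ 0 ∧ v(fv ℓ) = v(f_ℓ)) ∧
ι(u · JunctionDepletion S θ′ T φ x d) = C c′ · JunctionEuler p S₀ g ι fv» (the v23/v24 text at exponent `+f_ℓ` was the orientation `1+T ↔ γK`; honda's model has
`1+T ↔ γK⁻¹`). This file proves it — with the witnesses `fv := −frobeniusExponent`, `u := 1`, `c′ = p^d·∏_{w∈T}(−θ′(φ_w)·N(w))` — from the prefix data and ONE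
hypothesis `hEul`, the Euler-factor dictionary at the places of `S₀`: for `v ∈ S₀`, `P_{g,ℓ_v}(X) = 1 − ι(a_{ℓ_v})X + 𝟙_{ℓ_v∤M} ℓ_v X²` is the product over the places
`w ∣ ℓ_v` at which `θ` is unramified of `1 − θ(Frob_w)₀₀ · X^{f(w∣ℓ_v)}`. That dictionary is the PRINT residue of S1c (RULING «S1-EULER»): it holds because `g = θ_{ψ₀}`
(`hcoeffψ` + strong multiplicity one, Miyake Thm 4.6.19), `θ_{ψ₀}` has level `|d_K|·N(𝔣_ψ)` and `L(θ_{ψ₀}, s) = L(ψ₀, s)` (Miyake Thm 4.8.2), and `θ = λ_{ψ₀}` is ramified off `p`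
exactly at `supp 𝔣_ψ` with `θ(Frob_w) = ψ₀(w)` (Weil 1955 / Serre 1968 + Chebotarev); it is NOT proved here.
* §5 `iwasawaOToPowerSeries_depletionFactor` (one factor read in `ℚ̄_p⟦T⟧`), ★★★ `junctionEulerId_inv_of_eulerFactors` (the identity at exponent `−f_ℓ`, definite constant).
* §6 ★★★ `junctionEulerId_ns_of_eulerFactors` — the v25 conclusion VERBATIM with the line-file definitions unfolded (`∃ fv u c′ …`).
HONEST FRAMING: S1c is closed MODULO the print dictionary `hEul`; rows S3α/S3β/S4′, E2, crux L, crux M and BSD remain OPEN; BSD is proved for NO curve.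

References: [GreenbergVatsal2000] §1 p. 9, §2 Prop. (2.4); [Miyake2006] Thm. 4.6.19, Thm. 4.8.2; [SerreAbelianLadic1968] Ch. I §1.2, Ch. II §2.7; [Washington1997] §7.1, §13.2;
[PerrinRiou1994Invent] §1.3.
-/

set_option autoImplicit false
set_option linter.dupNamespace false -- D-0017: single-problem summit, the namespace repeats the problem name by design
noncomputable section

open scoped Classical
open NumberField IsDedekindDomain Field PowerSeries Rat.HeightOneSpectrum

namespace Summit.BirchSwinnertonDyer.BirchSwinnertonDyer.Theorems.SmallImageRttJunctionEuler

open Literature.NumberTheory.EllipticCurves Literature.NumberTheory.GaloisRepresentations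
  Literature.NumberTheory.ComplexMultiplication.EllipticUnits Literature.NumberTheory.ComplexMultiplication.EllipticUnits.JohnsonLeungKings2011
  Summit.BirchSwinnertonDyer.BirchSwinnertonDyer.Theorems.SmallImageRttD2J1 Summit.BirchSwinnertonDyer.BirchSwinnertonDyer.Theorems.SmallImageRttD2Seq
  IsDedekindDomain.HeightOneSpectrum Literature.NumberTheory.EllipticCurves.GreenbergVatsal2000

/-! ## §5 ★★★ The corrected Euler identity of the structural depletion, from the Euler-factor dictionary at the places of `S₀` -/

section EulerId

variable {p : ℕ} [Fact p.Prime] (hp : p ≠ 2) {κ : ZpExtension ℚ p} {K : Type} [Field K] [NumberField K] (hK2 : Module.finrank ℚ K = 2)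

/-- ★ **ONE DEPLETION FACTOR, READ IN `ℚ̄_p⟦T⟧`**: for `w ∣ ℓ_v` (`v ∈ S₀ ∌ (p)`), an arithmetic Frobenius `φ` at `𝔓₀(w)` and the exponent `x` of S1's clause,
`ι((1+T)^{x} − C(θ'(φ)·χ_p(φ))) = C(−N(w)/θ(φ)₀₀) · aeval (C ℓ_v⁻¹ · (1+T)^{−f_{ℓ_v}}) (1 − C θ(φ)₀₀ · X^{m})`, `N(w) = ℓ_v^m`. [cite: GreenbergVatsal2000, §2 Prop. (2.4)]
[cite: SerreAbelianLadic1968, Ch. I §1.2] [cite: Washington1997, §13.2] -/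
theorem iwasawaOToPowerSeries_depletionFactor (hκ : κ.IsCyclotomic) {γ : absoluteGaloisGroup ℚ} (hγ : κ.IsTopGenerator γ) (hcv : IsCyclotomicVariable p γ)
    (S : Set (PadicAlgCl p)) (θ : FramedGaloisRep K (padicCoeffIntegers S) 1) (θ' : absoluteGaloisGroup K →ₜ* (padicCoeffIntegers S)ˣ)
    (hθ'θ : ∀ g : absoluteGaloisGroup K, ((θ' g : (padicCoeffIntegers S)ˣ) : padicCoeffIntegers S) *
      ((θ g : GL (Fin 1) (padicCoeffIntegers S)) : Matrix (Fin 1) (Fin 1) (padicCoeffIntegers S)) 0 0 = 1)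
    {γK : absoluteGaloisGroup K} (hγK : (κ.restrictOfFinrankEqTwo hp K hK2).IsTopGenerator γK)
    {v : HeightOneSpectrum (𝓞 ℚ)} (hvp : ((p : ℕ) : 𝓞 ℚ) ∉ v.asIdeal) {w : HeightOneSpectrum (𝓞 K)} (hℓw : ((natGenerator v : ℕ) : 𝓞 K) ∈ w.asIdeal)
    {φ : absoluteGaloisGroup K} (hφ : IsArithFrobAt (𝓞 K) φ (adicCompletionPrime K w)) {x : ℤ_[p]}
    (hx : ∀ n : ℕ, γK⁻¹ ^ (PadicInt.toZModPow n x).val * φ⁻¹ ∈ (κ.restrictOfFinrankEqTwo hp K hK2).layerSubgroup n) :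
    iwasawaOToPowerSeries S (iwasawaToIwasawaO S (binomialSeries ℤ_[p] x) -
        PowerSeries.C (((θ' φ : (padicCoeffIntegers S)ˣ) : padicCoeffIntegers S) * padicIntToCoeffIntegers S ((GaloisRep.cyclotomicCharacter K p φ : ℤ_[p]ˣ) : ℤ_[p]))) =
      PowerSeries.C (-((((θ' φ : (padicCoeffIntegers S)ˣ) : padicCoeffIntegers S) : PadicAlgCl p) * (natGenerator v : PadicAlgCl p) ^ Nat.log (natGenerator v) w.residueCard)) *
        Polynomial.aeval (PowerSeries.C ((natGenerator v : PadicAlgCl p)⁻¹) * (binomialSeries ℤ_[p] (-frobeniusExponent p (natGenerator v : ℤ_[p]))).map (algebraMap ℤ_[p] (PadicAlgCl p)))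
          (1 - Polynomial.C ((((θ φ : GL (Fin 1) (padicCoeffIntegers S)) : Matrix (Fin 1) (Fin 1) (padicCoeffIntegers S)) 0 0 : padicCoeffIntegers S) : PadicAlgCl p) *
            Polynomial.X ^ Nat.log (natGenerator v) w.residueCard) := by
  have hℓ := prime_natGenerator v
  have hℓp : natGenerator v ≠ p := Summit.BirchSwinnertonDyer.Rank1Residual.X2.EulerFactorInvariants.natGenerator_ne_of_natCast_not_mem v hvp
  have hpw : ((p : ℕ) : 𝓞 K) ∉ w.asIdeal := SmallImageRttJunctionLocal.natCast_not_mem_of_natCast_mem hℓ Fact.out hℓp hℓw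
  have hm := residueCard_eq_pow_log hℓ hℓw
  set m := Nat.log (natGenerator v) w.residueCard with hmdef
  -- the exponent and the cyclotomic value
  have hxeq := eq_neg_natCast_mul_frobeniusExponent_of_mem_layerSubgroup hp hK2 hκ hγ hcv hγK hℓ hℓp hℓw hm (adicCompletionPrime_mem_primesAbove K w) hφ hx
  have hχ : ((GaloisRep.cyclotomicCharacter K p φ : ℤ_[p]ˣ) : ℤ_[p]) = ((natGenerator v : ℕ) : ℤ_[p]) ^ m := by
    rw [GaloisRep.cyclotomicCharacter_apply_of_isArithFrobAt hpw (adicCompletionPrime_mem_primesAbove K w) hφ, hm, Nat.cast_pow]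
  rw [map_sub, iwasawaOToPowerSeries_binomialSeries, Summit.BirchSwinnertonDyer.BirchSwinnertonDyer.Theorems.ThetaTransport.MazurTateValuesRelay.iwasawaOToPowerSeries_C, hxeq, hχ, ← mul_neg, binomialSeries_natCast_mul, map_pow, Subring.coe_mul,
    coe_padicIntToCoeffIntegers_natCast_pow]
  refine depletionFactor_eq_C_mul_aeval ?_ (mul_inv_cancel₀ (Nat.cast_ne_zero.mpr hℓ.ne_zero)) m _
  rw [← Subring.coe_mul, mul_comm, hθ'θ φ, Subring.coe_one]

/-- ★★★ **THE CORRECTED ROW S1c FROM THE EULER-FACTOR DICTIONARY.** Let `κ` be the cyclotomic `ℤ_p`-extension of `ℚ` normalised on a cyclotomic variable `γ`,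
`[K:ℚ] = 2`, `γK` a normalised generator of `κK`, `S₀ ∌ (p)` a finite set of rational places, `θ : Γ_K → GL₁(𝒪)` and `θ'` with `θ'·θ₀₀ = 1`, a level `𝔣` satisfying (R)
and (U) of `CharRoadFrameSupp`, a newform `g ∈ S₂(Γ₀(M))` with `p`-adic embedding `ι` of its Hecke field, and S1's datum `(T, φ, x, d)` (`T = S₀K ∖ supp(p𝔣)`, arithmetic
Frobenius elements, the exponent clause on `γK⁻¹`). ASSUME the Euler-factor dictionary at the places of `S₀` (PRINT for `g = θ_{ψ₀}`, `θ = λ_{ψ₀}`: Miyake Thm 4.8.2 + 4.6.19 / Ribet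
1977 Cor. 3.5, Weil–Serre–Tate): `P_{g,ℓ}(X) = 1 − ι(a_ℓ)X + 𝟙_{ℓ∤M} ℓX² = ∏_{w ∣ ℓ, θ unramified at w} (1 − θ(φ_w)₀₀ X^{deg w})` for every `ℓ = ℓ_v`, `v ∈ S₀`. THEN
**`ι(C(p^d) · ∏_{w∈T} ((1+T)^{x_w} − C(θ'(φ_w)χ_p(φ_w)))) = C c' · ∏_{v∈S₀} P_{g,ℓ_v}(ℓ_v⁻¹ (1+T)^{−f_{ℓ_v}})`** for a NON-ZERO constant `c'` — the line file's
`iwasawaOToPowerSeries S (JunctionDepletion S θ' T φ x d)` equals `C c'` times `JunctionEuler` WITH THE FROBENIUS EXPONENT NEGATED (`f_ℓ ↦ −f_ℓ`, i.e. `JunctionEuler^ι`);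
the v23/v24 text of `stub_junctionEulerId_ns` (exponent `+f_ℓ`) is the orientation of `1+T ↔ γK`, not honda's `1+T ↔ γK⁻¹`. [cite: GreenbergVatsal2000, §1 p. 9, §2 Prop. (2.4)]
[cite: Miyake2006, Thm. 4.8.2, Thm. 4.6.19] [cite: SerreAbelianLadic1968, Ch. I §1.2, Ch. II §2.7] [cite: Washington1997, §13.2] -/
theorem junctionEulerId_inv_of_eulerFactors (hκ : κ.IsCyclotomic) {γ : absoluteGaloisGroup ℚ} (hγ : κ.IsTopGenerator γ) (hcv : IsCyclotomicVariable p γ)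
    (S : Set (PadicAlgCl p)) (θ : FramedGaloisRep K (padicCoeffIntegers S) 1) (θ' : absoluteGaloisGroup K →ₜ* (padicCoeffIntegers S)ˣ)
    (hθ'θ : ∀ g : absoluteGaloisGroup K, ((θ' g : (padicCoeffIntegers S)ˣ) : padicCoeffIntegers S) *
      ((θ g : GL (Fin 1) (padicCoeffIntegers S)) : Matrix (Fin 1) (Fin 1) (padicCoeffIntegers S)) 0 0 = 1)
    {γK : absoluteGaloisGroup K} (hγK : (κ.restrictOfFinrankEqTwo hp K hK2).IsTopGenerator γK)
    (S₀ : Finset (HeightOneSpectrum (𝓞 ℚ))) (hS₀p : ∀ v ∈ S₀, ((p : ℕ) : 𝓞 ℚ) ∉ v.asIdeal) (𝔣 : Ideal (𝓞 K))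
    (hR : ∀ w ∈ suppPF p 𝔣, ((p : ℕ) : 𝓞 K) ∉ w.asIdeal → ∃ 𝔓 ∈ w.primesAbove, ∃ τ ∈ 𝔓.inertia (absoluteGaloisGroup K), θ' τ ≠ 1)
    (hU : ∀ w : HeightOneSpectrum (𝓞 K), w ∉ suppPF p 𝔣 → ∀ 𝔓 ∈ w.primesAbove, ∀ τ ∈ 𝔓.inertia (absoluteGaloisGroup K), θ' τ = 1)
    {M : ℕ} [NeZero M] (g : CuspForm (CongruenceSubgroup.Gamma0 M) 2) (ι : ModularForms.coeffField g →+* PadicAlgCl p)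
    (hEul : ∀ v ∈ S₀, ∀ (Tv : Finset (HeightOneSpectrum (𝓞 K))) (φ : HeightOneSpectrum (𝓞 K) → absoluteGaloisGroup K) (dg : HeightOneSpectrum (𝓞 K) → ℕ),
      (∀ w, w ∈ Tv ↔ (((natGenerator v : ℕ) : 𝓞 K) ∈ w.asIdeal ∧ θ.IsUnramifiedAt w)) →
      (∀ w ∈ Tv, IsArithFrobAt (𝓞 K) (φ w) (adicCompletionPrime K w)) →
      (∀ w ∈ Tv, w.residueCard = natGenerator v ^ dg w) →
      (1 - Polynomial.C (embCoeff g ι (natGenerator v)) * Polynomial.X +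
          (if natGenerator v ∣ M then 0 else Polynomial.C (natGenerator v : PadicAlgCl p)) * (Polynomial.X : Polynomial (PadicAlgCl p)) ^ 2) =
        ∏ w ∈ Tv, (1 - Polynomial.C ((((θ (φ w) : GL (Fin 1) (padicCoeffIntegers S)) : Matrix (Fin 1) (Fin 1) (padicCoeffIntegers S)) 0 0 : padicCoeffIntegers S) : PadicAlgCl p) *
          Polynomial.X ^ dg w))
    (T : Finset (HeightOneSpectrum (𝓞 K))) (φ : HeightOneSpectrum (𝓞 K) → absoluteGaloisGroup K) (x : HeightOneSpectrum (𝓞 K) → ℤ_[p]) (d : ℕ)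
    (hT : ∀ w, w ∈ T ↔ (w ∈ {w : HeightOneSpectrum (𝓞 K) | ∃ v ∈ S₀, ((natGenerator v : ℕ) : 𝓞 K) ∈ w.asIdeal} ∧ w ∉ suppPF p 𝔣))
    (hφ : ∀ w ∈ T, IsArithFrobAt (𝓞 K) (φ w) (adicCompletionPrime K w))
    (hx : ∀ w ∈ T, ∀ n : ℕ, γK⁻¹ ^ (PadicInt.toZModPow n (x w)).val * (φ w)⁻¹ ∈ (κ.restrictOfFinrankEqTwo hp K hK2).layerSubgroup n) :
    ∃ c' : PadicAlgCl p, c' ≠ 0 ∧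
      iwasawaOToPowerSeries S (PowerSeries.C ((p : padicCoeffIntegers S) ^ d) *
          ∏ w ∈ T, (iwasawaToIwasawaO S (binomialSeries ℤ_[p] (x w)) -
            PowerSeries.C (((θ' (φ w) : (padicCoeffIntegers S)ˣ) : padicCoeffIntegers S) *
              padicIntToCoeffIntegers S ((GaloisRep.cyclotomicCharacter K p (φ w) : ℤ_[p]ˣ) : ℤ_[p])))) =
        PowerSeries.C c' * ∏ v ∈ S₀, Polynomial.aeval (PowerSeries.C ((natGenerator v : PadicAlgCl p)⁻¹) *
            (binomialSeries ℤ_[p] (-frobeniusExponent p (natGenerator v : ℤ_[p]))).map (algebraMap ℤ_[p] (PadicAlgCl p)))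
          (1 - Polynomial.C (embCoeff g ι (natGenerator v)) * Polynomial.X +
            (if natGenerator v ∣ M then 0 else Polynomial.C (natGenerator v : PadicAlgCl p)) * (Polynomial.X : Polynomial (PadicAlgCl p)) ^ 2) := by
  -- the constant
  let cw : HeightOneSpectrum (𝓞 ℚ) → HeightOneSpectrum (𝓞 K) → PadicAlgCl p := fun v w ↦
    -((((θ' (φ w) : (padicCoeffIntegers S)ˣ) : padicCoeffIntegers S) : PadicAlgCl p) * (natGenerator v : PadicAlgCl p) ^ Nat.log (natGenerator v) w.residueCard)
  have hcw : ∀ v w, cw v w ≠ 0 := fun v w ↦ by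
    refine neg_ne_zero.mpr (mul_ne_zero ?_ (pow_ne_zero _ (Nat.cast_ne_zero.mpr (prime_natGenerator v).ne_zero)))
    intro h0
    have h1 := congrArg (fun z : padicCoeffIntegers S ↦ (z : PadicAlgCl p)) (hθ'θ (φ w))
    simp only [Subring.coe_mul, h0, zero_mul, Subring.coe_one] at h1
    exact zero_ne_one h1
  refine ⟨(p : PadicAlgCl p) ^ d * ∏ v ∈ S₀, ∏ w ∈ T.filter (fun w ↦ ((natGenerator v : ℕ) : 𝓞 K) ∈ w.asIdeal), cw v w,
    mul_ne_zero (pow_ne_zero _ (Nat.cast_ne_zero.mpr (Fact.out : p.Prime).ne_zero))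
      (Finset.prod_ne_zero_iff.mpr fun v _ ↦ Finset.prod_ne_zero_iff.mpr fun w _ ↦ hcw v w), ?_⟩
  -- per place `v ∈ S₀`: the product over the fibre is `C(∏ cw) · P_{g,ℓ_v}(ℓ_v⁻¹ (1+T)^{−f})`
  have hfib : ∀ v ∈ S₀, ∏ w ∈ T.filter (fun w ↦ ((natGenerator v : ℕ) : 𝓞 K) ∈ w.asIdeal),
      iwasawaOToPowerSeries S (iwasawaToIwasawaO S (binomialSeries ℤ_[p] (x w)) -
        PowerSeries.C (((θ' (φ w) : (padicCoeffIntegers S)ˣ) : padicCoeffIntegers S) * padicIntToCoeffIntegers S ((GaloisRep.cyclotomicCharacter K p (φ w) : ℤ_[p]ˣ) : ℤ_[p]))) =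
      PowerSeries.C (∏ w ∈ T.filter (fun w ↦ ((natGenerator v : ℕ) : 𝓞 K) ∈ w.asIdeal), cw v w) *
        Polynomial.aeval (PowerSeries.C ((natGenerator v : PadicAlgCl p)⁻¹) * (binomialSeries ℤ_[p] (-frobeniusExponent p (natGenerator v : ℤ_[p]))).map (algebraMap ℤ_[p] (PadicAlgCl p)))
          (1 - Polynomial.C (embCoeff g ι (natGenerator v)) * Polynomial.X +
            (if natGenerator v ∣ M then 0 else Polynomial.C (natGenerator v : PadicAlgCl p)) * (Polynomial.X : Polynomial (PadicAlgCl p)) ^ 2) := by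
    intro v hv
    have hmem := mem_filter_iff_mem_and_isUnramifiedAt θ θ' hθ'θ 𝔣 hR hU hS₀p hT hv
    rw [hEul v hv _ φ (fun w ↦ Nat.log (natGenerator v) w.residueCard) hmem (fun w hw ↦ hφ w (Finset.mem_filter.mp hw).1)
      (fun w hw ↦ residueCard_eq_pow_log (prime_natGenerator v) (Finset.mem_filter.mp hw).2), map_prod, map_prod, ← Finset.prod_mul_distrib]
    refine Finset.prod_congr rfl fun w hw ↦ ?_
    exact iwasawaOToPowerSeries_depletionFactor hp hK2 hκ hγ hcv S θ θ' hθ'θ hγK (hS₀p v hv) (Finset.mem_filter.mp hw).2 (hφ w (Finset.mem_filter.mp hw).1)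
      (hx w (Finset.mem_filter.mp hw).1)
  have hsplit : ∀ F : HeightOneSpectrum (𝓞 K) → PowerSeries (PadicAlgCl p),
      ∏ w ∈ T, F w = ∏ v ∈ S₀, ∏ w ∈ T.filter (fun w ↦ ((natGenerator v : ℕ) : 𝓞 K) ∈ w.asIdeal), F w := fun F ↦ by
    conv_lhs => rw [eq_biUnion_filter hT]
    exact Finset.prod_biUnion (pairwiseDisjoint_filter S₀ T)
  rw [map_mul, Summit.BirchSwinnertonDyer.BirchSwinnertonDyer.Theorems.ThetaTransport.MazurTateValuesRelay.iwasawaOToPowerSeries_C, map_prod, hsplit, Finset.prod_congr rfl hfib, Finset.prod_mul_distrib, ← mul_assoc, ← map_prod PowerSeries.C, ← map_mul]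
  congr 2

end EulerId

/-! ## §6 ★★★ The v25 stub `stub_junctionEulerId_ns` (∃ fv u c′) with its line-file definitions unfolded -/

section V25

variable {p : ℕ} [Fact p.Prime]

variable (hp : p ≠ 2) {κ : ZpExtension ℚ p} {K : Type} [Field K] [NumberField K] (hK2 : Module.finrank ℚ K = 2)

/-- ★★★ **ROW S1c OF LINE `rtt_w3` v25 (`stub_junctionEulerId_ns`), WITH `JunctionDepletion`/`JunctionEuler` UNFOLDED, FROM THE EULER-FACTOR DICTIONARY AT THE PLACES OF `S₀`**:
under the prefix data (`κ` cyclotomic normalised on the cyclotomic variable `γ`, `γK` normalised generator of `κK`, `S₀ ∌ (p)`, `θ'·θ₀₀ = 1` (frame conjunct 3), (R)/(U) of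
`CharRoadFrameSupp`) and the PRINT input `hEul` (the Euler factor `P_{g,ℓ}` of the newform `g` at every `ℓ = ℓ_v`, `v ∈ S₀`, is the product over the places `w ∣ ℓ` at which `θ` is
unramified of `1 − θ(Frob_w)₀₀ X^{f(w∣ℓ)}` — Miyake Thm 4.8.2 + 4.6.19 for `g = θ_{ψ₀}`, Weil–Serre–Tate + Chebotarev for `θ = λ_{ψ₀}`), for S1's datum `(T, φ, x, d)`:
**`∃ fv u c′`, `c′ ≠ 0`, `fv ℓ ≠ 0 ∧ v(fv ℓ) = v(f_ℓ)` on `S₀`, and `ι(u · JunctionDepletion S θ' T φ x d) = C c′ · JunctionEuler p S₀ g ι fv`** — with the witnesses `fv := −frobeniusExponent`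
(honda's model is generated by `γK⁻¹`), `u := 1`, `c′ = p^d · ∏_{w∈T} (−θ'(φ_w)·N(w))`. The LEAD closes the registered stub by `intro …; exact` this theorem once `hEul` is supplied from
the cite stub. [cite: GreenbergVatsal2000, §1 p. 9, §2 Prop. (2.4)] [cite: Miyake2006, Thm. 4.8.2, Thm. 4.6.19] [cite: SerreAbelianLadic1968, Ch. I §1.2] [cite: Washington1997, §13.2] -/
theorem junctionEulerId_ns_of_eulerFactors (hκ : κ.IsCyclotomic) {γ : absoluteGaloisGroup ℚ} (hγ : κ.IsTopGenerator γ) (hcv : IsCyclotomicVariable p γ)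
    (S : Set (PadicAlgCl p)) (θ : FramedGaloisRep K (padicCoeffIntegers S) 1) (θ' : absoluteGaloisGroup K →ₜ* (padicCoeffIntegers S)ˣ)
    (hθ'θ : ∀ g : absoluteGaloisGroup K, ((θ' g : (padicCoeffIntegers S)ˣ) : padicCoeffIntegers S) *
      ((θ g : GL (Fin 1) (padicCoeffIntegers S)) : Matrix (Fin 1) (Fin 1) (padicCoeffIntegers S)) 0 0 = 1)
    {γK : absoluteGaloisGroup K} (hγK : (κ.restrictOfFinrankEqTwo hp K hK2).IsTopGenerator γK)
    (S₀ : Finset (HeightOneSpectrum (𝓞 ℚ))) (hS₀p : ∀ v ∈ S₀, ((p : ℕ) : 𝓞 ℚ) ∉ v.asIdeal) (𝔣 : Ideal (𝓞 K))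
    (hR : ∀ w ∈ suppPF p 𝔣, ((p : ℕ) : 𝓞 K) ∉ w.asIdeal → ∃ 𝔓 ∈ w.primesAbove, ∃ τ ∈ 𝔓.inertia (absoluteGaloisGroup K), θ' τ ≠ 1)
    (hU : ∀ w : HeightOneSpectrum (𝓞 K), w ∉ suppPF p 𝔣 → ∀ 𝔓 ∈ w.primesAbove, ∀ τ ∈ 𝔓.inertia (absoluteGaloisGroup K), θ' τ = 1)
    {M : ℕ} [NeZero M] (g : CuspForm (CongruenceSubgroup.Gamma0 M) 2) (ι : ModularForms.coeffField g →+* PadicAlgCl p)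
    (hEul : ∀ v ∈ S₀, ∀ (Tv : Finset (HeightOneSpectrum (𝓞 K))) (φ : HeightOneSpectrum (𝓞 K) → absoluteGaloisGroup K) (dg : HeightOneSpectrum (𝓞 K) → ℕ),
      (∀ w, w ∈ Tv ↔ (((natGenerator v : ℕ) : 𝓞 K) ∈ w.asIdeal ∧ θ.IsUnramifiedAt w)) →
      (∀ w ∈ Tv, IsArithFrobAt (𝓞 K) (φ w) (adicCompletionPrime K w)) →
      (∀ w ∈ Tv, w.residueCard = natGenerator v ^ dg w) →
      (1 - Polynomial.C (embCoeff g ι (natGenerator v)) * Polynomial.X +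
          (if natGenerator v ∣ M then 0 else Polynomial.C (natGenerator v : PadicAlgCl p)) * (Polynomial.X : Polynomial (PadicAlgCl p)) ^ 2) =
        ∏ w ∈ Tv, (1 - Polynomial.C ((((θ (φ w) : GL (Fin 1) (padicCoeffIntegers S)) : Matrix (Fin 1) (Fin 1) (padicCoeffIntegers S)) 0 0 : padicCoeffIntegers S) : PadicAlgCl p) *
          Polynomial.X ^ dg w))
    (T : Finset (HeightOneSpectrum (𝓞 K))) (φ : HeightOneSpectrum (𝓞 K) → absoluteGaloisGroup K) (x : HeightOneSpectrum (𝓞 K) → ℤ_[p]) (d : ℕ)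
    (hT : ∀ w, w ∈ T ↔ (w ∈ {w : HeightOneSpectrum (𝓞 K) | ∃ v ∈ S₀, ((natGenerator v : ℕ) : 𝓞 K) ∈ w.asIdeal} ∧ w ∉ suppPF p 𝔣))
    (hφ : ∀ w ∈ T, IsArithFrobAt (𝓞 K) (φ w) (adicCompletionPrime K w))
    (hx : ∀ w ∈ T, ∀ n : ℕ, γK⁻¹ ^ (PadicInt.toZModPow n (x w)).val * (φ w)⁻¹ ∈ (κ.restrictOfFinrankEqTwo hp K hK2).layerSubgroup n) :
    ∃ (fv : HeightOneSpectrum (𝓞 ℚ) → ℤ_[p]) (u : (IwasawaAlgebraO S)ˣ) (c' : PadicAlgCl p), c' ≠ 0 ∧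
      (∀ w ∈ S₀, fv w ≠ 0 ∧ (fv w).valuation = (frobeniusExponent p (natGenerator w : ℤ_[p])).valuation) ∧
      iwasawaOToPowerSeries S ((u : IwasawaAlgebraO S) * (PowerSeries.C ((p : padicCoeffIntegers S) ^ d) *
          ∏ w ∈ T, (iwasawaToIwasawaO S (PowerSeries.binomialSeries ℤ_[p] (x w)) -
            PowerSeries.C (((θ' (φ w) : (padicCoeffIntegers S)ˣ) : padicCoeffIntegers S) *
              padicIntToCoeffIntegers S ((GaloisRep.cyclotomicCharacter K p (φ w) : ℤ_[p]ˣ) : ℤ_[p]))))) =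
        PowerSeries.C c' * ∏ w ∈ S₀, Polynomial.aeval (PowerSeries.C ((natGenerator w : PadicAlgCl p)⁻¹) *
            (PowerSeries.binomialSeries ℤ_[p] (fv w)).map (algebraMap ℤ_[p] (PadicAlgCl p)))
          (1 - Polynomial.C (embCoeff g ι (natGenerator w)) * Polynomial.X +
            (if natGenerator w ∣ M then 0 else Polynomial.C (natGenerator w : PadicAlgCl p)) * (Polynomial.X : Polynomial (PadicAlgCl p)) ^ 2) := by
  obtain ⟨c', hc', hid⟩ := junctionEulerId_inv_of_eulerFactors hp hK2 hκ hγ hcv S θ θ' hθ'θ hγK S₀ hS₀p 𝔣 hR hU g ι hEul T φ x d hT hφ hx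
  refine ⟨fun v ↦ -frobeniusExponent p (natGenerator v : ℤ_[p]), 1, c', hc', fun v hv ↦ ⟨?_, Literature.NumberTheory.EllipticCurves.padicInt_valuation_neg _⟩, by rw [Units.val_one, one_mul]; exact hid⟩
  exact neg_ne_zero.mpr (SmallImageRttE2Num.frobeniusExponent_natGenerator_ne_zero v
    (Summit.BirchSwinnertonDyer.Rank1Residual.X2.EulerFactorInvariants.natGenerator_ne_of_natCast_not_mem v (hS₀p v hv)))

end V25

end Summit.BirchSwinnertonDyer.BirchSwinnertonDyer.Theorems.SmallImageRttJunctionEuler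

end
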